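import Literature.Probability.RandomPlanarGeometry.SAWWidePolygons
import Literature.Probability.Percolation.DualContours
import HarnessLib

/-!
# Extremal vertices of edge sets of `ℤ²`: east-north, west-north, west-south; the plaquette sides at
# the east-north vertex of a polygon

Topic `Literature/Probability/RandomPlanarGeometry` (continues `SAWWidePolygons.lean`; infrastructure for
the join `J` of DGHM20 Lemma 3.3, `SAWWidePolygonsJoin.lean`).

Source: H. Duminil-Copin, S. Ganguly, A. Hammond, I. Manolescu, *Bounding the number of
self-avoiding walks: Hammersley–Welsh with polygon insertion*, Ann. Probab. 48 (2020),
arXiv:1809.00760, proof of Lemma 3.3: "we may specify the west-south vertex of `p`, `WS(p)`, (and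
its east-north vertex `EN(p)`) to be the lowest among the leftmost (and the highest among the
rightmost) elements of `ℤ²` visited by the walk `p`"; "The union of the edges that comprise `p` and
this translation of `τ(q)` intersects the four edges of the plaquette whose north-west corner is
`EN(p)` along the west and east sides of the plaquette".

## Contents (namespace `Literature.Probability.RandomPlanarGeometry.SAW`), all PROVED

* `ex`, `ey` — the unit vectors of `ℤ²`; `adj_add_ex`, `adj_cases` (the four neighbours).
* `IsEN E a`, `IsWN E c`, `IsWS E a` — east-north / west-north / west-south vertices: existence
  (`exists_isEN`, `exists_isWS`), uniqueness, covariance under translation (`IsEN.shift`, …) and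
  under the reflection `τ` (`IsEN.reflect : EN ↦ WN`); the choices `enV`, `wsV` and
  `relHeight E = y(EN) − y(WS)`.
* `edge_down_mem_of_isEN`, `edge_down_mem_of_isWN` — at the east-north (west-north) vertex `a` of a
  polygon the edge `{a, a − e₁}` belongs to the polygon (its other edge at `a` being `{a, a ∓ e₀}`).
* `IsPolygon.vertsOf_nonempty`.
-/

noncomputable section

open Finset SimpleGraph Literature.Probability.LatticeModels Literature.Probability.Percolation
open Literature.Barriers.CriticalPhenomena.SupercriticalSAW (shiftEdges isPolygon_shiftEdges
  card_shiftEdges mem_shiftEdges_iff shiftEdges_injective)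
open Literature.Probability.Percolation.SiteGadgetSystem (vertsOf mem_vertsOf)

namespace Literature.Probability.RandomPlanarGeometry.SAW

/-! (`Contour.site_ext` — two sites of `ℤ²` with equal coordinates are equal — is the tree's,
`Literature/Probability/Percolation/DualContours.lean`.) -/

/-- The horizontal unit vector `e₀ = (1, 0)`. [cite: DuminilCopinGangulyHammondManolescu2020, §1.1 (notation)] -/
def ex : Site 2 := Pi.single 0 1

/-- The vertical unit vector `e₁ = (0, 1)`. [cite: DuminilCopinGangulyHammondManolescu2020, §1.1 (notation)] -/
def ey : Site 2 := Pi.single 1 1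

/-- `e₀ = (1, 0)`: first coordinate. [cite: MadrasSlade1993, §1.1 (the hypercubic lattice)] -/
@[simp] theorem ex_zero : ex 0 = 1 := by simp [ex]

/-- `e₀ = (1, 0)`: second coordinate. [cite: MadrasSlade1993, §1.1 (the hypercubic lattice)] -/
@[simp] theorem ex_one : ex 1 = 0 := by simp [ex]

/-- `e₁ = (0, 1)`: first coordinate. [cite: MadrasSlade1993, §1.1 (the hypercubic lattice)] -/
@[simp] theorem ey_zero : ey 0 = 0 := by simp [ey]

/-- `e₁ = (0, 1)`: second coordinate. [cite: MadrasSlade1993, §1.1 (the hypercubic lattice)] -/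
@[simp] theorem ey_one : ey 1 = 1 := by simp [ey]

/-- `v` and `v + e₀` are adjacent in `ℤ²`. [cite: MadrasSlade1993, §1.1 (nearest neighbours of ℤ^d)] -/
theorem adj_add_ex (v : Site 2) : (zdGraph 2).Adj v (v + ex) :=
  (zdGraph_adj_iff v (v + ex)).2 ⟨0, Or.inl rfl⟩

/-- A neighbour of `v` in `ℤ²` is one of `v ± e₀`, `v ± e₁`. [cite: MadrasSlade1993, §1.1 (nearest neighbours of ℤ^d)] -/
theorem adj_cases {v w : Site 2} (h : (zdGraph 2).Adj v w) :
    w = v + ex ∨ w = v - ex ∨ w = v + ey ∨ w = v - ey := by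
  obtain ⟨i, hi | hi⟩ := (zdGraph_adj_iff v w).1 h
  · fin_cases i
    · exact Or.inl hi
    · exact Or.inr (Or.inr (Or.inl hi))
  · fin_cases i
    · exact Or.inr (Or.inl (by rw [hi]; simp [ex]))
    · exact Or.inr (Or.inr (Or.inr (by rw [hi]; simp [ey])))

/-! ### Extremal vertices: east-north, west-north, west-south -/

/-- `a` is the EAST-NORTH vertex of `E`: the highest among the rightmost vertices.
[cite: DuminilCopinGangulyHammondManolescu2020, §3.1 (proof of Lemma 3.3: EN(p))] -/
def IsEN (E : Finset (Sym2 (Site 2))) (a : Site 2) : Prop :=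
  a ∈ vertsOf E ∧ ∀ v ∈ vertsOf E, v 0 ≤ a 0 ∧ (v 0 = a 0 → v 1 ≤ a 1)

/-- `c` is the WEST-NORTH vertex of `E`: the highest among the leftmost vertices (the image of `EN`
under the reflection `τ`). [cite: DuminilCopinGangulyHammondManolescu2020, §3.1 (proof of Lemma 3.3)] -/
def IsWN (E : Finset (Sym2 (Site 2))) (c : Site 2) : Prop :=
  c ∈ vertsOf E ∧ ∀ v ∈ vertsOf E, c 0 ≤ v 0 ∧ (v 0 = c 0 → v 1 ≤ c 1)

/-- `a` is the WEST-SOUTH vertex of `E`: the lowest among the leftmost vertices.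
[cite: DuminilCopinGangulyHammondManolescu2020, §3.1 (proof of Lemma 3.3: WS(p))] -/
def IsWS (E : Finset (Sym2 (Site 2))) (a : Site 2) : Prop :=
  a ∈ vertsOf E ∧ ∀ v ∈ vertsOf E, a 0 ≤ v 0 ∧ (v 0 = a 0 → a 1 ≤ v 1)

/-- Every edge set with a vertex has an east-north vertex.
[cite: DuminilCopinGangulyHammondManolescu2020, §3.1 (proof of Lemma 3.3)] -/
theorem exists_isEN {E : Finset (Sym2 (Site 2))} (hne : (vertsOf E).Nonempty) : ∃ a, IsEN E a := by
  obtain ⟨a₁, ha₁, h₁⟩ := exists_max_image (vertsOf E) (fun v => v 0) hne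
  have hT : ((vertsOf E).filter fun v => v 0 = a₁ 0).Nonempty := ⟨a₁, mem_filter.2 ⟨ha₁, rfl⟩⟩
  obtain ⟨a, ha, h₂⟩ := exists_max_image _ (fun v => v 1) hT
  obtain ⟨haE, ha0⟩ := mem_filter.1 ha
  refine ⟨a, haE, fun v hv => ⟨by rw [ha0]; exact h₁ v hv, fun hv0 => h₂ v (mem_filter.2 ⟨hv, ?_⟩)⟩⟩
  rw [hv0, ha0]

/-- Every edge set with a vertex has a west-south vertex.
[cite: DuminilCopinGangulyHammondManolescu2020, §3.1 (proof of Lemma 3.3)] -/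
theorem exists_isWS {E : Finset (Sym2 (Site 2))} (hne : (vertsOf E).Nonempty) : ∃ a, IsWS E a := by
  obtain ⟨a₁, ha₁, h₁⟩ := exists_min_image (vertsOf E) (fun v => v 0) hne
  have hT : ((vertsOf E).filter fun v => v 0 = a₁ 0).Nonempty := ⟨a₁, mem_filter.2 ⟨ha₁, rfl⟩⟩
  obtain ⟨a, ha, h₂⟩ := exists_min_image _ (fun v => v 1) hT
  obtain ⟨haE, ha0⟩ := mem_filter.1 ha
  refine ⟨a, haE, fun v hv => ⟨by rw [ha0]; exact h₁ v hv, fun hv0 => h₂ v (mem_filter.2 ⟨hv, ?_⟩)⟩⟩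
  rw [hv0, ha0]

/-- The east-north vertex is unique. [cite: DuminilCopinGangulyHammondManolescu2020, §3.1 (proof of Lemma 3.3)] -/
theorem IsEN.unique {E : Finset (Sym2 (Site 2))} {a a' : Site 2} (h : IsEN E a) (h' : IsEN E a') :
    a = a' := by
  have h1 := (h.2 a' h'.1).1
  have h2 := (h'.2 a h.1).1
  have h0 : a 0 = a' 0 := le_antisymm h2 h1
  exact Contour.site_ext h0 (le_antisymm ((h'.2 a h.1).2 h0) ((h.2 a' h'.1).2 h0.symm))

/-- The west-south vertex is unique. [cite: DuminilCopinGangulyHammondManolescu2020, §3.1 (proof of Lemma 3.3)] -/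
theorem IsWS.unique {E : Finset (Sym2 (Site 2))} {a a' : Site 2} (h : IsWS E a) (h' : IsWS E a') :
    a = a' := by
  have h1 := (h.2 a' h'.1).1
  have h2 := (h'.2 a h.1).1
  have h0 : a 0 = a' 0 := le_antisymm h1 h2
  exact Contour.site_ext h0 (le_antisymm ((h.2 a' h'.1).2 h0.symm) ((h'.2 a h.1).2 h0))

/-- `EN` is translation covariant. [cite: DuminilCopinGangulyHammondManolescu2020, §3.1 (proof of Lemma 3.3)] -/
theorem IsEN.shift {E : Finset (Sym2 (Site 2))} {a : Site 2} (h : IsEN E a) (t : Site 2) :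
    IsEN (shiftEdges t E) (a + t) := by
  refine ⟨add_mem_vertsOf_shiftEdges.2 h.1, fun v hv => ?_⟩
  have := h.2 (v - t) (mem_vertsOf_shiftEdges.1 hv)
  simp only [Pi.sub_apply, Pi.add_apply] at this ⊢
  exact ⟨by linarith [this.1], fun h0 => by linarith [this.2 (by linarith)]⟩

/-- `WS` is translation covariant. [cite: DuminilCopinGangulyHammondManolescu2020, §3.1 (proof of Lemma 3.3)] -/
theorem IsWS.shift {E : Finset (Sym2 (Site 2))} {a : Site 2} (h : IsWS E a) (t : Site 2) :
    IsWS (shiftEdges t E) (a + t) := by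
  refine ⟨add_mem_vertsOf_shiftEdges.2 h.1, fun v hv => ?_⟩
  have := h.2 (v - t) (mem_vertsOf_shiftEdges.1 hv)
  simp only [Pi.sub_apply, Pi.add_apply] at this ⊢
  exact ⟨by linarith [this.1], fun h0 => by linarith [this.2 (by linarith)]⟩

/-- `WN` is translation covariant. [cite: DuminilCopinGangulyHammondManolescu2020, §3.1 (proof of Lemma 3.3)] -/
theorem IsWN.shift {E : Finset (Sym2 (Site 2))} {c : Site 2} (h : IsWN E c) (t : Site 2) :
    IsWN (shiftEdges t E) (c + t) := by
  refine ⟨add_mem_vertsOf_shiftEdges.2 h.1, fun v hv => ?_⟩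
  have := h.2 (v - t) (mem_vertsOf_shiftEdges.1 hv)
  simp only [Pi.sub_apply, Pi.add_apply] at this ⊢
  exact ⟨by linarith [this.1], fun h0 => by linarith [this.2 (by linarith)]⟩

/-- The reflection `τ` turns the east-north vertex into the west-north vertex.
[cite: DuminilCopinGangulyHammondManolescu2020, §3.1 (proof of Lemma 3.3: "its vertex in correspondence with EN(q)")] -/
theorem IsEN.reflect {E : Finset (Sym2 (Site 2))} {a : Site 2} (h : IsEN E a) (K : ℤ) :
    IsWN (reflEdges K E) (Zd.reflAt 0 K a) := by
  refine ⟨mem_vertsOf_reflEdges.2 (by rw [Zd.reflAt_reflAt]; exact h.1), fun v hv => ?_⟩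
  have := h.2 _ (mem_vertsOf_reflEdges.1 hv)
  simp only [Zd.reflAt_apply_same, Zd.reflAt_apply_of_ne (show (1 : Fin 2) ≠ 0 by decide)] at this ⊢
  exact ⟨by linarith [this.1], fun h0 => this.2 (by linarith)⟩

/-- The east-north vertex of `E` (junk `0` if `E` has no vertex).
[cite: DuminilCopinGangulyHammondManolescu2020, §3.1 (proof of Lemma 3.3)] -/
def enV (E : Finset (Sym2 (Site 2))) : Site 2 :=
  if h : (vertsOf E).Nonempty then Classical.choose (exists_isEN h) else 0

/-- The west-south vertex of `E` (junk `0` if `E` has no vertex).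
[cite: DuminilCopinGangulyHammondManolescu2020, §3.1 (proof of Lemma 3.3)] -/
def wsV (E : Finset (Sym2 (Site 2))) : Site 2 :=
  if h : (vertsOf E).Nonempty then Classical.choose (exists_isWS h) else 0

/-- `enV E` is the east-north vertex. [cite: DuminilCopinGangulyHammondManolescu2020, §3.1 (proof of Lemma 3.3)] -/
theorem isEN_enV {E : Finset (Sym2 (Site 2))} (h : (vertsOf E).Nonempty) : IsEN E (enV E) := by
  rw [enV, dif_pos h]; exact Classical.choose_spec (exists_isEN h)

/-- `wsV E` is the west-south vertex. [cite: DuminilCopinGangulyHammondManolescu2020, §3.1 (proof of Lemma 3.3)] -/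
theorem isWS_wsV {E : Finset (Sym2 (Site 2))} (h : (vertsOf E).Nonempty) : IsWS E (wsV E) := by
  rw [wsV, dif_pos h]; exact Classical.choose_spec (exists_isWS h)

/-- The height of `EN` above `WS` (translation invariant).
[cite: DuminilCopinGangulyHammondManolescu2020, §3.1 (proof of Lemma 3.3: "y(EN(p)) = y(EN(q))" for WS-rooted p, q)] -/
def relHeight (E : Finset (Sym2 (Site 2))) : ℤ := enV E 1 - wsV E 1

/-! ### The downward edge at an east-north / west-north vertex of a polygon -/

/-- At the east-north vertex `a` of a polygon, the polygon uses the edge `{a, a − e₁}` (the west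
side of the plaquette with north-west corner `a`).
[cite: DuminilCopinGangulyHammondManolescu2020, §3.1 (proof of Lemma 3.3: "intersects the four edges of the plaquette … along the west and east sides")] -/
theorem edge_down_mem_of_isEN {E : Finset (Sym2 (Site 2))} (hE : IsPolygon (zdGraph 2) E) {a : Site 2}
    (ha : IsEN E a) : s(a, a - ey) ∈ E := by
  obtain ⟨b₁, b₂, hne, h₁, h₂, hadj₁, hadj₂⟩ := hE.exists_two_edges (mem_vertsOf.1 ha.1)
  have hb₁ : b₁ ∈ vertsOf E := mem_verts_of_mem h₁ (Sym2.mem_mk_right a b₁)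
  have hb₂ : b₂ ∈ vertsOf E := mem_verts_of_mem h₂ (Sym2.mem_mk_right a b₂)
  -- neither neighbour is `a + e₀` or `a + e₁`
  have key : ∀ b, b ∈ vertsOf E → (zdGraph 2).Adj a b → b = a - ex ∨ b = a - ey := by
    intro b hb hadj
    have hb' := ha.2 b hb
    rcases adj_cases hadj with rfl | rfl | rfl | rfl
    · simp at hb'
    · exact Or.inl rfl
    · have := hb'.2 (by simp); simp at this
    · exact Or.inr rfl
  rcases key b₁ hb₁ hadj₁ with rfl | rfl
  · rcases key b₂ hb₂ hadj₂ with rfl | rfl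
    · exact absurd rfl hne
    · exact h₂
  · exact h₁

/-- At the west-north vertex `c` of a polygon, the polygon uses the edge `{c, c − e₁}` (the east
side of the plaquette). [cite: DuminilCopinGangulyHammondManolescu2020, §3.1 (proof of Lemma 3.3)] -/
theorem edge_down_mem_of_isWN {E : Finset (Sym2 (Site 2))} (hE : IsPolygon (zdGraph 2) E) {c : Site 2}
    (hc : IsWN E c) : s(c, c - ey) ∈ E := by
  obtain ⟨b₁, b₂, hne, h₁, h₂, hadj₁, hadj₂⟩ := hE.exists_two_edges (mem_vertsOf.1 hc.1)
  have hb₁ : b₁ ∈ vertsOf E := mem_verts_of_mem h₁ (Sym2.mem_mk_right c b₁)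
  have hb₂ : b₂ ∈ vertsOf E := mem_verts_of_mem h₂ (Sym2.mem_mk_right c b₂)
  have key : ∀ b, b ∈ vertsOf E → (zdGraph 2).Adj c b → b = c + ex ∨ b = c - ey := by
    intro b hb hadj
    have hb' := hc.2 b hb
    rcases adj_cases hadj with rfl | rfl | rfl | rfl
    · exact Or.inl rfl
    · simp at hb'
    · have := hb'.2 (by simp); simp at this
    · exact Or.inr rfl
  rcases key b₁ hb₁ hadj₁ with rfl | rfl
  · rcases key b₂ hb₂ hadj₂ with rfl | rfl
    · exact absurd rfl hne
    · exact h₂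
  · exact h₁

/-- A polygon has a vertex. [cite: MadrasSlade1993, Definition 3.2.1 (self-avoiding polygons)] -/
theorem IsPolygon.vertsOf_nonempty {E : Finset (Sym2 (Site 2))} (hE : IsPolygon (zdGraph 2) E) :
    (vertsOf E).Nonempty := by
  obtain ⟨u, c, hc, rfl⟩ := hE
  exact ⟨u, (mem_vertsOf_iff_mem_support hc).2 c.start_mem_support⟩

end Literature.Probability.RandomPlanarGeometry.SAW
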